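import Mathlib.Analysis.Matrix.PosDef
import Mathlib.Analysis.Matrix.Spectrum
import Mathlib.Analysis.Matrix.Hermitian
import Mathlib.Analysis.Real.Sqrt
import Mathlib.Algebra.Order.BigOperators.Ring.Finset
import Literature.LinearAlgebra.Matrix.HermitianAeval
import HarnessLib

/-!
# Nearly idempotent Hermitian matrices: spectrum in `[-δ, 1+δ]` and the affine shrink into `0 ⪯ Q ⪯ 1`

Textbook finite-dimensional spectral calculus — polynomial eigenpairs [HornJohnson2013, Thm. 1.1.6],
the spectral theorem for Hermitian matrices [HornJohnson2013, Thm. 4.1.5], "positive semidefinite iff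
all eigenvalues are non-negative" [HornJohnson2013, Thm. 7.2.1; Def. (7.1.1b)], congruence
[HornJohnson2013, Obs. 7.1.8(a)] and the Frobenius norm [HornJohnson2013, (5.6.0.2)] — packaged in
the LOEWNER form [HornJohnson2013, Def. 7.7.1] in which finite certificates use it. For a Hermitian
matrix `H` over `𝕜 = ℝ` or `ℂ`:

* `posSemidef_aeval_of_eval_nonneg` / `eval_nonneg_of_posSemidef_aeval` — `q(H) ⪰ 0` iff the
  real polynomial `q` is non-negative at every eigenvalue of `H` (spectral mapping);
* `eigenvalues_sub_sq_nonneg_of_posSemidef`, `eigenvalues_mem_Icc_of_posSemidef_sub_sq` — if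
  `δ·1 + (H - H·H) ⪰ 0` (the Loewner form of "`H - H² ⪰ -δ`", `H` *nearly idempotent*) then every
  eigenvalue `λ` of `H` satisfies `λ(1 - λ) ≥ -δ`, hence `λ ∈ [-δ, 1 + δ]` (`0 ≤ δ`);
* `posSemidef_affine_shrink` — consequently, for real `a, b` with `0 ≤ a`, `a·δ ≤ b`,
  `a·(1 + δ) + b ≤ 1`, the AFFINE SHRINK `Q := a·H + b·1` satisfies `0 ⪯ Q ⪯ 1`
  (`Q.PosSemidef ∧ (1 - Q).PosSemidef`);
* quadratic-form entry points: `posSemidef_smul_one_add_of_re_le` (`M` Hermitian and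
  `-δ Σᵢ‖xᵢ‖² ≤ re (x* M x)` for all `x` ⇒ `δ·1 + M ⪰ 0`), the Frobenius primitive
  `norm_star_dotProduct_mulVec_le` (`‖x* B x‖ ≤ ‖B‖_F · Σᵢ‖xᵢ‖²` for ANY square `B`), and the
  summed form `posSemidef_sum_smul_one_add_sum` (`M = Σ_{r ∈ s} B_r` Hermitian with
  `‖B_r‖_F ≤ c_r` ⇒ `(Σ_r c_r)·1 + M ⪰ 0`); `posSemidef_affine_shrink_of_sum` chains the two;
* `eigenvalues_mem_Icc_zero_one_of_posSemidef` / `posSemidef_and_one_sub_of_eigenvalues_mem_Icc` —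
  the Loewner sandwich `0 ⪯ Q ⪯ 1` is equivalent to "every eigenvalue of `Q` lies in `[0, 1]`"
  (the bridge between the Loewner-form hypotheses and eigenvalue-list hypotheses);
* `posSemidef_sum_smul_one_add_sum_sq` / `posSemidef_affine_shrink_of_sum_sq` — the same with the
  Frobenius hypotheses in the squared form `Σᵢⱼ‖(B_r)ᵢⱼ‖² ≤ c_r²`, `0 ≤ c_r` (rational-checkable).

Motivation (not used in the proofs): a translation-invariant one-body density given by finitely
many rational momentum blocks `Q̃(κ)` is an admissible Hartree–Fock datum only if `0 ⪯ Q̃(κ) ⪯ 1`;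
a certificate exhibits `Q̃ - Q̃² = Σ_R B_R` with Frobenius bounds `‖B_R‖_F ≤ c_R`, after which the
lemmas here deliver `0 ⪯ aQ̃ + b·1 ⪯ 1` from three rational inequalities on `(a, b, Σ c_R)`.

## References
* [HornJohnson2013] R. A. Horn, C. R. Johnson, *Matrix Analysis*, 2nd ed., CUP 2013 (held:
  `book:horn2012-matrix-analysis`): Thm. 1.1.6 (if `(λ, x)` is an eigenpair of `A` then
  `(p(λ), x)` is an eigenpair of `p(A)`), Thm. 4.1.5 (spectral theorem `A = UΛU*`), Thm. 4.1.8 /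
  Thm. 7.2.1 (`A` Hermitian is positive semidefinite iff all eigenvalues are non-negative),
  Def. (7.1.1b) (`x*Ax ≥ 0`), Obs. 7.1.3 (non-negative combinations), Obs. 7.1.8(a) (`C*AC ⪰ 0`),
  (5.6.0.2) (Frobenius norm, with the Cauchy–Schwarz display that follows it), Def. 7.7.1
  (Loewner partial order).
-/

noncomputable section

open Matrix Polynomial
open scoped ComplexOrder

namespace Literature.LinearAlgebra.Matrix

variable {𝕜 : Type*} [RCLike 𝕜] {n : Type*} [Fintype n] [DecidableEq n]

/-! ### Real scalars and quadratic forms over `RCLike` -/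

omit [Fintype n] in
/-- `(c : 𝕜) • 1 ⪰ 0` for a real `c ≥ 0`. [cite: HornJohnson2013, Obs. 7.1.3] -/
theorem posSemidef_real_smul_one {c : ℝ} (hc : 0 ≤ c) :
    ((c : 𝕜) • (1 : Matrix n n 𝕜)).PosSemidef := by
  rw [smul_one_eq_diagonal]
  exact posSemidef_diagonal_iff.mpr fun _ => RCLike.ofReal_nonneg.mpr hc

omit [Fintype n] in
/-- `(c : 𝕜) • 1` is Hermitian for a real `c` (plumbing). [folklore] -/
private theorem isHermitian_real_smul_one (c : ℝ) : ((c : 𝕜) • (1 : Matrix n n 𝕜)).IsHermitian := by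
  rw [smul_one_eq_diagonal]
  exact isHermitian_diagonal_iff.mpr fun _ => by
    rw [isSelfAdjoint_iff, RCLike.star_def, RCLike.conj_ofReal]

omit [DecidableEq n] in
/-- `x* x = Σᵢ ‖xᵢ‖²` (as an element of `𝕜`; plumbing). [folklore] -/
private theorem star_dotProduct_self_eq_sum_norm_sq (x : n → 𝕜) :
    star x ⬝ᵥ x = ((∑ i, ‖x i‖ ^ 2 : ℝ) : 𝕜) := by
  simp only [dotProduct, Pi.star_apply, RCLike.star_def, RCLike.conj_mul]
  push_cast
  rfl

/-- **Quadratic-form test for a shifted Hermitian matrix**: if `M` is Hermitian and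
`-δ Σᵢ‖xᵢ‖² ≤ re (x* M x)` for every `x`, then `δ·1 + M ⪰ 0` — the definition of positive
semidefiniteness by the quadratic form, `x*(δ·1 + M)x = δ‖x‖² + x*Mx ≥ 0`.
[cite: HornJohnson2013, Def. (7.1.1b)] -/
theorem posSemidef_smul_one_add_of_re_le {M : Matrix n n 𝕜} (hM : M.IsHermitian) {δ : ℝ}
    (h : ∀ x : n → 𝕜, -(δ * ∑ i, ‖x i‖ ^ 2) ≤ RCLike.re (star x ⬝ᵥ (M *ᵥ x))) :
    ((δ : 𝕜) • (1 : Matrix n n 𝕜) + M).PosSemidef := by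
  refine PosSemidef.of_dotProduct_mulVec_nonneg ((isHermitian_real_smul_one δ).add hM) fun x => ?_
  have hexp : star x ⬝ᵥ (((δ : 𝕜) • (1 : Matrix n n 𝕜) + M) *ᵥ x) =
      (δ : 𝕜) * ((∑ i, ‖x i‖ ^ 2 : ℝ) : 𝕜) + star x ⬝ᵥ (M *ᵥ x) := by
    rw [add_mulVec, smul_mulVec, one_mulVec, dotProduct_add, dotProduct_smul, smul_eq_mul,
      star_dotProduct_self_eq_sum_norm_sq]
  rw [hexp, RCLike.nonneg_iff]
  constructor
  · have := h x
    rw [map_add, ← RCLike.ofReal_mul, RCLike.ofReal_re]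
    linarith
  · rw [map_add, ← RCLike.ofReal_mul, RCLike.ofReal_im, hM.im_star_dotProduct_mulVec_self, add_zero]

omit [DecidableEq n] in
/-- **Frobenius bound on a quadratic form**: `‖x* B x‖ ≤ ‖B‖_F · Σᵢ‖xᵢ‖²` for ANY square matrix `B`,
`‖B‖_F = (Σᵢⱼ ‖Bᵢⱼ‖²)^{1/2}` — the Cauchy–Schwarz computation printed after (5.6.0.2) (there for
`‖AB‖_F ≤ ‖A‖_F‖B‖_F`), here on the index set `n × n` with `a = (‖Bᵢⱼ‖)`, `b = (‖xᵢ‖‖xⱼ‖)`.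
[cite: HornJohnson2013, (5.6.0.2)] -/
theorem norm_star_dotProduct_mulVec_le (B : Matrix n n 𝕜) (x : n → 𝕜) :
    ‖star x ⬝ᵥ (B *ᵥ x)‖ ≤ Real.sqrt (∑ i, ∑ j, ‖B i j‖ ^ 2) * ∑ i, ‖x i‖ ^ 2 := by
  have hexp : star x ⬝ᵥ (B *ᵥ x) = ∑ i, ∑ j, star (x i) * (B i j * x j) := by
    simp only [dotProduct, mulVec, Pi.star_apply, Finset.mul_sum]
  have hP : 0 ≤ ∑ p : n × n, ‖B p.1 p.2‖ ^ 2 := Finset.sum_nonneg fun _ _ => sq_nonneg _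
  have hX : 0 ≤ ∑ i, ‖x i‖ ^ 2 := Finset.sum_nonneg fun _ _ => sq_nonneg _
  have hS : 0 ≤ ∑ p : n × n, ‖B p.1 p.2‖ * (‖x p.1‖ * ‖x p.2‖) :=
    Finset.sum_nonneg fun _ _ => by positivity
  calc ‖star x ⬝ᵥ (B *ᵥ x)‖
      ≤ ∑ i, ∑ j, ‖B i j‖ * (‖x i‖ * ‖x j‖) := by
        rw [hexp]
        refine (norm_sum_le _ _).trans (Finset.sum_le_sum fun i _ =>
          (norm_sum_le _ _).trans (Finset.sum_le_sum fun j _ => ?_))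
        rw [norm_mul, norm_mul, norm_star]
        exact le_of_eq (by ring)
    _ = ∑ p : n × n, ‖B p.1 p.2‖ * (‖x p.1‖ * ‖x p.2‖) := (Fintype.sum_prod_type' _).symm
    _ ≤ Real.sqrt ((∑ p : n × n, ‖B p.1 p.2‖ ^ 2) * ∑ p : n × n, (‖x p.1‖ * ‖x p.2‖) ^ 2) :=
        Real.le_sqrt_of_sq_le (Finset.sum_mul_sq_le_sq_mul_sq _ _ _)
    _ = Real.sqrt (∑ i, ∑ j, ‖B i j‖ ^ 2) * ∑ i, ‖x i‖ ^ 2 := by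
        have hsq : ∑ p : n × n, (‖x p.1‖ * ‖x p.2‖) ^ 2 = (∑ i, ‖x i‖ ^ 2) ^ 2 := by
          rw [Fintype.sum_prod_type, sq (∑ i, ‖x i‖ ^ 2), Fintype.sum_mul_sum]
          simp only [mul_pow]
        have hB : ∑ p : n × n, ‖B p.1 p.2‖ ^ 2 = ∑ i, ∑ j, ‖B i j‖ ^ 2 := by
          rw [Fintype.sum_prod_type]
        rw [hsq, Real.sqrt_mul hP, Real.sqrt_sq hX, hB]

/-- **Summed Frobenius test**: if `M = Σ_{r ∈ s} B_r` is Hermitian (the `B_r` need not be) and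
`‖B_r‖_F ≤ c_r` for `r ∈ s`, then `(Σ_{r ∈ s} c_r)·1 + M ⪰ 0` (quadratic form + triangle
inequality + the Frobenius bound). [cite: HornJohnson2013, Def. (7.1.1b) with (5.6.0.2)] -/
theorem posSemidef_sum_smul_one_add_sum {ι : Type*} (s : Finset ι) (B : ι → Matrix n n 𝕜)
    (c : ι → ℝ) (hM : (∑ r ∈ s, B r).IsHermitian)
    (hc : ∀ r ∈ s, Real.sqrt (∑ i, ∑ j, ‖B r i j‖ ^ 2) ≤ c r) :
    (((∑ r ∈ s, c r : ℝ) : 𝕜) • (1 : Matrix n n 𝕜) + ∑ r ∈ s, B r).PosSemidef := by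
  refine posSemidef_smul_one_add_of_re_le hM fun x => ?_
  have hX : 0 ≤ ∑ i, ‖x i‖ ^ 2 := Finset.sum_nonneg fun _ _ => sq_nonneg _
  rw [sum_mulVec, dotProduct_sum, map_sum, Finset.sum_mul, ← Finset.sum_neg_distrib]
  refine Finset.sum_le_sum fun r hr => ?_
  have h1 : -‖star x ⬝ᵥ (B r *ᵥ x)‖ ≤ RCLike.re (star x ⬝ᵥ (B r *ᵥ x)) :=
    (abs_le.mp (RCLike.abs_re_le_norm _)).1
  have h2 := norm_star_dotProduct_mulVec_le (B r) x
  have h3 : Real.sqrt (∑ i, ∑ j, ‖B r i j‖ ^ 2) * ∑ i, ‖x i‖ ^ 2 ≤ c r * ∑ i, ‖x i‖ ^ 2 :=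
    mul_le_mul_of_nonneg_right (hc r hr) hX
  linarith

/-! ### Spectral mapping in Loewner form -/

/-- `U · diag(d) · U*` is positive semidefinite for a real `d ≥ 0` (any square `U`): congruence
preserves positive semidefiniteness (a `private` copy of the lemma of the same content in
`PolarDecompositionGeneral.lean`, kept local to avoid importing the SVD/CFC stack).
[cite: HornJohnson2013, Obs. 7.1.8(a)] -/
private theorem posSemidef_mul_diagonal_mul_star' (U : Matrix n n 𝕜) {d : n → ℝ} (hd : ∀ k, 0 ≤ d k) :
    PosSemidef (U * diagonal (fun k => ((d k : ℝ) : 𝕜)) * star U) := by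
  have hD : PosSemidef (diagonal (fun k => ((d k : ℝ) : 𝕜))) :=
    posSemidef_diagonal_iff.mpr fun k => RCLike.ofReal_nonneg.mpr (hd k)
  simpa only [star_eq_conjTranspose] using hD.mul_mul_conjTranspose_same U

/-- **Spectral mapping, Loewner form (⇐)**: if the real polynomial `q` is non-negative at every
eigenvalue of the Hermitian matrix `H`, then `q(H) ⪰ 0` (`q(H) = U q(Λ) U*` by the spectral theorem,
and a Hermitian matrix with non-negative eigenvalues is positive semidefinite).
[cite: HornJohnson2013, Thm. 4.1.5 with Thm. 7.2.1] -/
theorem posSemidef_aeval_of_eval_nonneg {H : Matrix n n 𝕜} (hH : H.IsHermitian) (q : ℝ[X])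
    (hq : ∀ k, 0 ≤ q.eval (hH.eigenvalues k)) : (aeval H q).PosSemidef := by
  rw [aeval_eq_conj_diagonal hH]
  exact posSemidef_mul_diagonal_mul_star' _ hq

/-- `q(H) v_k = q(λ_k) v_k` on Mathlib's orthonormal eigenvector basis: if `(λ, x)` is an eigenpair
of `H` then `(q(λ), x)` is an eigenpair of `q(H)`. [cite: HornJohnson2013, Thm. 1.1.6] -/
theorem aeval_mulVec_eigenvectorBasis {H : Matrix n n 𝕜} (hH : H.IsHermitian) (q : ℝ[X])
    (k : n) :
    aeval H q *ᵥ ⇑(hH.eigenvectorBasis k) =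
      ((q.eval (hH.eigenvalues k) : ℝ) : 𝕜) • ⇑(hH.eigenvectorBasis k) := by
  rw [aeval_eq_conj_diagonal hH, ← mulVec_mulVec, ← mulVec_mulVec,
    hH.star_eigenvectorUnitary_mulVec, diagonal_mulVec_single, mul_one]
  have hs : (Pi.single k ((q.eval (hH.eigenvalues k) : ℝ) : 𝕜) : n → 𝕜) =
      ((q.eval (hH.eigenvalues k) : ℝ) : 𝕜) • (Pi.single k (1 : 𝕜) : n → 𝕜) := by
    rw [← Pi.single_smul, smul_eq_mul, mul_one]
  rw [hs, mulVec_smul, hH.eigenvectorUnitary_mulVec]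

/-- The quadratic form of `q(H)` at the unit eigenvector `v_k` is `q(λ_k)` (Rayleigh quotient at an
eigenvector). [cite: HornJohnson2013, Thm. 1.1.6] -/
theorem star_eigenvectorBasis_dotProduct_aeval_mulVec {H : Matrix n n 𝕜} (hH : H.IsHermitian)
    (q : ℝ[X]) (k : n) :
    star ⇑(hH.eigenvectorBasis k) ⬝ᵥ (aeval H q *ᵥ ⇑(hH.eigenvectorBasis k)) =
      ((q.eval (hH.eigenvalues k) : ℝ) : 𝕜) := by
  rw [aeval_mulVec_eigenvectorBasis hH q k, dotProduct_smul, smul_eq_mul, dotProduct_comm,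
    ← EuclideanSpace.inner_eq_star_dotProduct, inner_self_eq_norm_sq_to_K,
    hH.eigenvectorBasis.orthonormal.1 k]
  simp

/-- **Spectral mapping, Loewner form (⇒)**: if `q(H) ⪰ 0` then `q` is non-negative at every
eigenvalue of `H` (each `q(λ_k)` is an eigenvalue of `q(H)`, and the eigenvalues of a positive
semidefinite matrix are non-negative). [cite: HornJohnson2013, Thm. 1.1.6 with Thm. 7.2.1] -/
theorem eval_nonneg_of_posSemidef_aeval {H : Matrix n n 𝕜} (hH : H.IsHermitian) (q : ℝ[X])
    (h : (aeval H q).PosSemidef) (k : n) : 0 ≤ q.eval (hH.eigenvalues k) := by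
  have h1 := h.re_dotProduct_nonneg ⇑(hH.eigenvectorBasis k)
  rwa [star_eigenvectorBasis_dotProduct_aeval_mulVec hH q k, RCLike.ofReal_re] at h1

/-! ### Nearly idempotent Hermitian matrices and the affine shrink -/

/-- `δ·1 + (H - H·H)` is the real polynomial `C δ + X - X²` evaluated at `H` (plumbing). [folklore] -/
private theorem aeval_C_add_X_sub_X_sq (H : Matrix n n 𝕜) (δ : ℝ) :
    aeval H (C δ + X - X ^ 2) = (δ : 𝕜) • (1 : Matrix n n 𝕜) + (H - H * H) := by
  rw [map_sub, map_add, map_pow, aeval_C, aeval_X, Algebra.algebraMap_eq_smul_one,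
    RCLike.real_smul_eq_coe_smul (K := 𝕜), sq, add_sub_assoc]

/-- `a·H + b·1` is the real polynomial `C a · X + C b` evaluated at `H` (plumbing). [folklore] -/
private theorem aeval_C_mul_X_add_C (H : Matrix n n 𝕜) (a b : ℝ) :
    aeval H (C a * X + C b) = (a : 𝕜) • H + (b : 𝕜) • (1 : Matrix n n 𝕜) := by
  rw [map_add, map_mul, aeval_C, aeval_C, aeval_X, Algebra.algebraMap_eq_smul_one,
    Algebra.algebraMap_eq_smul_one, smul_one_mul, RCLike.real_smul_eq_coe_smul (K := 𝕜) a,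
    RCLike.real_smul_eq_coe_smul (K := 𝕜) b]

/-- **Nearly idempotent ⇒ `λ(1 - λ) ≥ -δ`**: if `H` is Hermitian and `δ·1 + (H - H·H) ⪰ 0`
(Loewner form of `H - H² ⪰ -δ·1`), then `0 ≤ δ + λ - λ²` for every eigenvalue `λ` of `H` — the
spectral mapping `p(t) = δ + t - t²` read through "positive semidefinite iff non-negative eigenvalues".
[cite: HornJohnson2013, Thm. 1.1.6 with Thm. 7.2.1] -/
theorem eigenvalues_sub_sq_nonneg_of_posSemidef {H : Matrix n n 𝕜} (hH : H.IsHermitian) {δ : ℝ}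
    (h : ((δ : 𝕜) • (1 : Matrix n n 𝕜) + (H - H * H)).PosSemidef) (k : n) :
    0 ≤ δ + hH.eigenvalues k - hH.eigenvalues k ^ 2 := by
  rw [← aeval_C_add_X_sub_X_sq] at h
  have := eval_nonneg_of_posSemidef_aeval hH _ h k
  simpa using this

/-- … hence every eigenvalue lies in `[-δ, 1 + δ]` (for `0 ≤ δ`; the sharp interval is
`[-η, 1 + η]` with `η = (√(1 + 4δ) - 1)/2 ≤ δ`): elementary from `λ(1 - λ) ≥ -δ`.
[cite: HornJohnson2013, Thm. 1.1.6 with Thm. 7.2.1] -/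
theorem eigenvalues_mem_Icc_of_posSemidef_sub_sq {H : Matrix n n 𝕜} (hH : H.IsHermitian)
    {δ : ℝ} (hδ : 0 ≤ δ) (h : ((δ : 𝕜) • (1 : Matrix n n 𝕜) + (H - H * H)).PosSemidef) (k : n) :
    hH.eigenvalues k ∈ Set.Icc (-δ) (1 + δ) := by
  have h0 := eigenvalues_sub_sq_nonneg_of_posSemidef hH h k
  constructor
  · by_contra hlt
    rw [not_le] at hlt
    nlinarith [hlt, hδ, sq_nonneg (hH.eigenvalues k)]
  · by_contra hlt
    rw [not_le] at hlt
    nlinarith [hlt, hδ, sq_nonneg (hH.eigenvalues k)]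

omit [Fintype n] in
/-- Monotonicity of the Loewner hypothesis in `δ`: `δ·1 + M ⪰ 0` and `δ ≤ δ'` give `δ'·1 + M ⪰ 0`
(`(δ' - δ)·1 ⪰ 0` is added; a certificate may therefore verify the shrink inequalities with any
upper bound `δ' ≥ δ`). [cite: HornJohnson2013, Obs. 7.1.3] -/
theorem posSemidef_smul_one_add_mono {M : Matrix n n 𝕜} {δ δ' : ℝ} (hle : δ ≤ δ')
    (h : ((δ : 𝕜) • (1 : Matrix n n 𝕜) + M).PosSemidef) :
    ((δ' : 𝕜) • (1 : Matrix n n 𝕜) + M).PosSemidef := by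
  have hsplit : (δ' : 𝕜) • (1 : Matrix n n 𝕜) + M =
      ((δ' - δ : ℝ) : 𝕜) • (1 : Matrix n n 𝕜) + ((δ : 𝕜) • (1 : Matrix n n 𝕜) + M) := by
    rw [← add_assoc, ← add_smul, RCLike.ofReal_sub, sub_add_cancel]
  rw [hsplit]
  exact (posSemidef_real_smul_one (sub_nonneg.mpr hle)).add h

/-- **The affine shrink**: if `H` is Hermitian and nearly idempotent, `δ·1 + (H - H·H) ⪰ 0` with
`0 ≤ δ`, and the real numbers `a, b` satisfy `0 ≤ a`, `a·δ ≤ b`, `a·(1 + δ) + b ≤ 1`, then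
`Q := a·H + b·1` satisfies `0 ⪯ Q` and `Q ⪯ 1`. (Every eigenvalue `λ ∈ [-δ, 1 + δ]` is mapped to
`aλ + b ∈ [b - aδ, a(1 + δ) + b] ⊆ [0, 1]`, and `p(H) ⪰ 0` for `p(t) = at + b`, `p(t) = 1 - at - b`
by the spectral theorem.) [cite: HornJohnson2013, Thm. 4.1.5 with Thm. 7.2.1] -/
theorem posSemidef_affine_shrink {H : Matrix n n 𝕜} (hH : H.IsHermitian) {δ a b : ℝ}
    (hδ : 0 ≤ δ) (h : ((δ : 𝕜) • (1 : Matrix n n 𝕜) + (H - H * H)).PosSemidef)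
    (ha : 0 ≤ a) (hab : a * δ ≤ b) (hab1 : a * (1 + δ) + b ≤ 1) :
    ((a : 𝕜) • H + (b : 𝕜) • (1 : Matrix n n 𝕜)).PosSemidef ∧
      (1 - ((a : 𝕜) • H + (b : 𝕜) • (1 : Matrix n n 𝕜))).PosSemidef := by
  have hev := eigenvalues_mem_Icc_of_posSemidef_sub_sq hH hδ h
  constructor
  · rw [← aeval_C_mul_X_add_C]
    refine posSemidef_aeval_of_eval_nonneg hH _ fun k => ?_
    have hk := hev k
    simp only [eval_add, eval_mul, eval_C, eval_X]
    nlinarith [hk.1, hk.2, ha, hab]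
  · have e2 : 1 - ((a : 𝕜) • H + (b : 𝕜) • (1 : Matrix n n 𝕜)) = aeval H (1 - (C a * X + C b)) := by
      rw [map_sub, map_one, aeval_C_mul_X_add_C]
    rw [e2]
    refine posSemidef_aeval_of_eval_nonneg hH _ fun k => ?_
    have hk := hev k
    simp only [eval_sub, eval_one, eval_add, eval_mul, eval_C, eval_X]
    nlinarith [hk.1, hk.2, ha, hab1]

/-- **End-to-end form for a finite certificate**: `H` Hermitian, `H - H·H = Σ_{r ∈ s} B_r` with
Frobenius bounds `‖B_r‖_F ≤ c_r`, and `a, b` with `0 ≤ a`, `a·(Σ c_r) ≤ b`, `a·(1 + Σ c_r) + b ≤ 1`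
⇒ `0 ⪯ a·H + b·1 ⪯ 1` (the previous results chained). [cite: HornJohnson2013, Thm. 4.1.5 with
Thm. 7.2.1 and (5.6.0.2)] -/
theorem posSemidef_affine_shrink_of_sum {H : Matrix n n 𝕜} (hH : H.IsHermitian) {ι : Type*}
    (s : Finset ι) (B : ι → Matrix n n 𝕜) (c : ι → ℝ) (hdec : H - H * H = ∑ r ∈ s, B r)
    (hc : ∀ r ∈ s, Real.sqrt (∑ i, ∑ j, ‖B r i j‖ ^ 2) ≤ c r) {a b : ℝ} (ha : 0 ≤ a)
    (hab : a * (∑ r ∈ s, c r) ≤ b) (hab1 : a * (1 + ∑ r ∈ s, c r) + b ≤ 1) :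
    ((a : 𝕜) • H + (b : 𝕜) • (1 : Matrix n n 𝕜)).PosSemidef ∧
      (1 - ((a : 𝕜) • H + (b : 𝕜) • (1 : Matrix n n 𝕜))).PosSemidef := by
  have hHH : (H - H * H).IsHermitian := by
    refine hH.sub ?_
    change (H * H)ᴴ = H * H
    rw [conjTranspose_mul, hH.eq]
  have hδ : 0 ≤ ∑ r ∈ s, c r :=
    Finset.sum_nonneg fun r hr => (Real.sqrt_nonneg _).trans (hc r hr)
  have hM : (∑ r ∈ s, B r).IsHermitian := hdec ▸ hHH
  have hL := posSemidef_sum_smul_one_add_sum s B c hM hc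
  rw [← hdec] at hL
  exact posSemidef_affine_shrink hH hδ hL ha hab hab1

/-! ### The Loewner sandwich `0 ⪯ Q ⪯ 1` versus the eigenvalue box `[0, 1]` -/

/-- From the Loewner sandwich to the eigenvalue box: if `0 ⪯ Q` and `Q ⪯ 1` then every eigenvalue of
`Q` lies in `[0, 1]`. [cite: HornJohnson2013, Thm. 7.2.1 with Thm. 1.1.6] -/
theorem eigenvalues_mem_Icc_zero_one_of_posSemidef {Q : Matrix n n 𝕜} (h0 : Q.PosSemidef)
    (h1 : (1 - Q).PosSemidef) (k : n) : h0.1.eigenvalues k ∈ Set.Icc (0 : ℝ) 1 := by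
  refine ⟨h0.eigenvalues_nonneg k, ?_⟩
  have e : (1 : Matrix n n 𝕜) - Q = aeval Q (1 - X : ℝ[X]) := by rw [map_sub, map_one, aeval_X]
  rw [e] at h1
  have := eval_nonneg_of_posSemidef_aeval h0.1 _ h1 k
  simp only [eval_sub, eval_one, eval_X] at this
  linarith

/-- From the eigenvalue box to the Loewner sandwich: if `H` is Hermitian with every eigenvalue in
`[0, 1]` then `0 ⪯ H` and `H ⪯ 1`. [cite: HornJohnson2013, Thm. 7.2.1 with Thm. 4.1.5] -/
theorem posSemidef_and_one_sub_of_eigenvalues_mem_Icc {H : Matrix n n 𝕜} (hH : H.IsHermitian)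
    (h : ∀ k, hH.eigenvalues k ∈ Set.Icc (0 : ℝ) 1) : H.PosSemidef ∧ (1 - H).PosSemidef := by
  refine ⟨hH.posSemidef_iff_eigenvalues_nonneg.mpr fun k => (h k).1, ?_⟩
  have e : (1 : Matrix n n 𝕜) - H = aeval H (1 - X : ℝ[X]) := by rw [map_sub, map_one, aeval_X]
  rw [e]
  refine posSemidef_aeval_of_eval_nonneg hH _ fun k => ?_
  simp only [eval_sub, eval_one, eval_X]
  linarith [(h k).2]

/-! ### Squared-hypothesis forms (what a rational certificate actually checks: `Σᵢⱼ‖Bᵢⱼ‖² ≤ c²`) -/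

/-- **Summed Frobenius test, squared form**: `M = Σ_{r ∈ s} B_r` Hermitian, `0 ≤ c_r` and
`Σᵢⱼ ‖(B_r)ᵢⱼ‖² ≤ c_r²` for `r ∈ s` ⇒ `(Σ_{r ∈ s} c_r)·1 + M ⪰ 0` (no square root for the reader to
evaluate). [cite: HornJohnson2013, Def. (7.1.1b) with (5.6.0.2)] -/
theorem posSemidef_sum_smul_one_add_sum_sq {ι : Type*} (s : Finset ι) (B : ι → Matrix n n 𝕜)
    (c : ι → ℝ) (hM : (∑ r ∈ s, B r).IsHermitian) (hc0 : ∀ r ∈ s, 0 ≤ c r)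
    (hc : ∀ r ∈ s, ∑ i, ∑ j, ‖B r i j‖ ^ 2 ≤ c r ^ 2) :
    (((∑ r ∈ s, c r : ℝ) : 𝕜) • (1 : Matrix n n 𝕜) + ∑ r ∈ s, B r).PosSemidef :=
  posSemidef_sum_smul_one_add_sum s B c hM fun r hr =>
    (Real.sqrt_le_sqrt (hc r hr)).trans (le_of_eq (Real.sqrt_sq (hc0 r hr)))

/-- **End-to-end form, squared hypotheses**: `H` Hermitian, `H - H·H = Σ_{r ∈ s} B_r`, `0 ≤ c_r`,
`Σᵢⱼ ‖(B_r)ᵢⱼ‖² ≤ c_r²`, and `0 ≤ a`, `a·(Σ c_r) ≤ b`, `a·(1 + Σ c_r) + b ≤ 1`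
⇒ `0 ⪯ a·H + b·1 ⪯ 1`. [cite: HornJohnson2013, Thm. 4.1.5 with Thm. 7.2.1 and (5.6.0.2)] -/
theorem posSemidef_affine_shrink_of_sum_sq {H : Matrix n n 𝕜} (hH : H.IsHermitian) {ι : Type*}
    (s : Finset ι) (B : ι → Matrix n n 𝕜) (c : ι → ℝ) (hdec : H - H * H = ∑ r ∈ s, B r)
    (hc0 : ∀ r ∈ s, 0 ≤ c r) (hc : ∀ r ∈ s, ∑ i, ∑ j, ‖B r i j‖ ^ 2 ≤ c r ^ 2) {a b : ℝ}
    (ha : 0 ≤ a) (hab : a * (∑ r ∈ s, c r) ≤ b) (hab1 : a * (1 + ∑ r ∈ s, c r) + b ≤ 1) :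
    ((a : 𝕜) • H + (b : 𝕜) • (1 : Matrix n n 𝕜)).PosSemidef ∧
      (1 - ((a : 𝕜) • H + (b : 𝕜) • (1 : Matrix n n 𝕜))).PosSemidef :=
  posSemidef_affine_shrink_of_sum hH s B c hdec
    (fun r hr => (Real.sqrt_le_sqrt (hc r hr)).trans (le_of_eq (Real.sqrt_sq (hc0 r hr))))
    ha hab hab1

end Literature.LinearAlgebra.Matrix
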